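import Literature.NumberTheory.LFunctions.ExplicitZeroFreeRegionKernel
import HarnessLib

/-!
# The Laplace transform of the MTY kernel: Kadiri's expansion `F(z) = f(0)/z + F₂(z)/z²` (Lemma 3.2) and `K(w, θ)`

Topic `Literature/NumberTheory/LFunctions`; part of the decomposition of the named fact
`Literature.NumberTheory.LFunctions.zero_free_region_mossinghoff_trudgian_yang` (rh.S09 explicit;
Mossinghoff–Trudgian–Yang 2024 = arXiv:2212.06867, Theorem 1.3, §9), continuing
`ExplicitZeroFreeRegionKernel.lean` (the kernel `h^{(1)}_{1,θ}` of MTY (9.2) = `g ∗ g`, its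
closed-form derivatives and Kadiri's conditions (H₁)). All the explicit error terms of Kadiri's
method (`C₁, …, C₄`, Kadiri 2005 §§2.4, 4; Mossinghoff–Trudgian 2015 §4) rest on one structural
fact about the Laplace transform `F` of the test function `f` (Kadiri, Lemma 3.2 and its proof):

> `F(s) = f(0)/s + F₂(s)/s²`, `F₂` the Laplace transform of `f''`, hence
> `F̃(x, y) = ηg₁(θ) x/(x² + y²) + H(x, y)` with `|H(x, y)| ≤ M(x/η)η²/(x² + y²)`,
> `M(z) = ∫₀^{d₁(θ)} |h''(u)| e^{−zu} du`.

**Everything in this file is proved; no named fact is introduced.**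

* `laplace_eq_of_H1` — for any real `f ∈ C²` with `f(d) = f'(0) = f'(d) = 0` and complex `z ≠ 0`:
  `∫₀^d f e^{−zt} = f(0)/z + z⁻² ∫₀^d f'' e^{−zt}` (two integrations by parts);
  `kadiri_lemma32` — hence `|Re F(z) − f(0) Re z/‖z‖²| ≤ (∫₀^d |f''| e^{−(Re z)t})/‖z‖²`.
* For the MTY kernel (`f = h^{(1)}_{1,θ}`, `d = d₁(θ)`, `f(0) = g₁(θ) = fordSmoothW0 θ`, (H₁) from
  the Kernel file): `mtyH1_laplace_eq`, `kadiri_lemma32_mtyH1` with `M = mtyM θ`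
  (`= ∫₀^{d₁}|h''|e^{−xu}`, a definition), and the printed scaled form for `f = ηh(η·)`
  (`kadiri_f_laplace_eq_scaled`: `F_f(z) = F_h(z/η)`; `kadiri_lemma32_scaled`: Lemma 3.2 verbatim).
* `mtyLaplace θ x = F̃(x, 0)` (a definition), non-increasing in `x` (`antitone_mtyLaplace`, from
  `h ≥ 0`), `‖F(z)‖ ≤ F̃(Re z, 0)` (`norm_laplace_mtyH1_le`); and Kadiri's / Mossinghoff–Trudgian's
  `K(w, θ) = ∫₀^{d₁} (a₁e^{−u} − a₀) h(u) e^{wu} du` (`kadiriK`, a definition) with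
  `K(w, θ) = a₁F̃(1 − w, 0) − a₀F̃(−w, 0)` (`kadiriK_eq`) — the denominator of the master inequality
  (2.2) of Mossinghoff–Trudgian 2015.

Not here: the numerical bounds `M(z) ≤ M*(z, θ)` via the moments `M_k(θ)` (MT2015 §4), the
monotonicity of `K(·, θ)` on `[0, 1]` for `θ = 1.13489` (MTY §9, verified numerically there), and
Kadiri's third-order refinement Lemma 3.3.

## References

* H. Kadiri, *Une région explicite sans zéros pour la fonction ζ de Riemann*, Acta Arith. 117
  (2005) 303–339 = arXiv:math/0401238: §2.2 (`f = ηh_θ(η·)`, (2.4) `F̃`), §2.4 (`K(ω)`),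
  Lemma 3.2 and its proof, §4. [cite: Kadiri2005]
* M. J. Mossinghoff, T. S. Trudgian, J. Number Theory 157 (2015) = arXiv:1410.3926, §2 (`K(w, θ)`,
  (2.2)), §4 (`M(z, θ)`, `M*`). [cite: MossinghoffTrudgian2015]
* M. J. Mossinghoff, T. S. Trudgian, A. Yang, Res. Number Theory 10 (2024) = arXiv:2212.06867, §9,
  (9.2). [cite: MossinghoffTrudgianYangRNT2024]
-/

noncomputable section

open Real MeasureTheory Set intervalIntegral

namespace Literature.NumberTheory.LFunctions

/-! ## The Laplace transform of an (H₁) test function: `F(z) = f(0)/z + F₂(z)/z²` -/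

/-- `d/dt e^{-zt} = -z e^{-zt}` for complex `z`, real `t`. [folklore] -/
theorem hasDerivAt_cexp_neg_mul (z : ℂ) (t : ℝ) :
    HasDerivAt (fun t : ℝ ↦ Complex.exp (-(z * t))) (-z * Complex.exp (-(z * t))) t := by
  have h1 : HasDerivAt (fun t : ℝ ↦ -(z * (t : ℂ))) (-(z * 1)) t :=
    (((hasDerivAt_id' t).ofReal_comp).const_mul z).neg
  exact (h1.cexp).congr_deriv (by ring)

/-- **Two integrations by parts** (Kadiri 2005, proof of Lemma 3.2: "`F(s) = f(0)/s + F₂(s)/s²`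
où `F₂` est la transformée de Laplace de `f''`"). If `f ∈ C²` with `f(d) = 0`, `f'(0) = 0`,
`f'(d) = 0` (three of the four conditions (H₁)), then for every complex `z ≠ 0`
`∫₀^d f(t) e^{−zt} dt = f(0)/z + z⁻² ∫₀^d f''(t) e^{−zt} dt`. [cite: Kadiri2005, Lemma 3.2 (proof)] -/
theorem laplace_eq_of_H1 {f f' f'' : ℝ → ℝ} {d : ℝ}
    (hf : ∀ t, HasDerivAt f (f' t) t) (hf' : ∀ t, HasDerivAt f' (f'' t) t) (hf''c : Continuous f'')
    (hfd : f d = 0) (hf'0 : f' 0 = 0) (hf'd : f' d = 0) {z : ℂ} (hz : z ≠ 0) :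
    ∫ t in (0 : ℝ)..d, (f t : ℂ) * Complex.exp (-(z * t))
      = f 0 / z + 1 / z ^ 2 * ∫ t in (0 : ℝ)..d, (f'' t : ℂ) * Complex.exp (-(z * t)) := by
  -- the primitive `v(t) = -e^{-zt}/z` of `e^{-zt}`
  set v : ℝ → ℂ := fun t ↦ -Complex.exp (-(z * t)) / z with hv
  have hvd : ∀ t : ℝ, HasDerivAt v (Complex.exp (-(z * (t : ℂ)))) t := by
    intro t
    have := ((hasDerivAt_cexp_neg_mul z t).neg).div_const z
    refine this.congr_deriv ?_
    field_simp
  have hfc : Continuous f' := continuous_iff_continuousAt.2 fun t ↦ (hf' t).continuousAt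
  have hec : Continuous fun t : ℝ ↦ Complex.exp (-(z * t)) := by fun_prop
  -- first integration by parts
  have h1 := integral_mul_deriv_eq_deriv_mul (a := 0) (b := d)
    (u := fun t ↦ (f t : ℂ)) (u' := fun t ↦ (f' t : ℂ)) (v := v) (v' := fun t ↦ Complex.exp (-(z * t)))
    (fun t _ ↦ (hf t).ofReal_comp) (fun t _ ↦ hvd t)
    ((Complex.continuous_ofReal.comp hfc).intervalIntegrable _ _) (hec.intervalIntegrable _ _)
  -- second integration by parts
  have h2 := integral_mul_deriv_eq_deriv_mul (a := 0) (b := d)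
    (u := fun t ↦ (f' t : ℂ)) (u' := fun t ↦ (f'' t : ℂ)) (v := v) (v' := fun t ↦ Complex.exp (-(z * t)))
    (fun t _ ↦ (hf' t).ofReal_comp) (fun t _ ↦ hvd t)
    ((Complex.continuous_ofReal.comp hf''c).intervalIntegrable _ _) (hec.intervalIntegrable _ _)
  beta_reduce at h1 h2
  have hv0 : v 0 = -1 / z := by simp [hv]
  rw [hfd, hv0] at h1
  rw [hf'd, hf'0, hv0] at h2
  simp only [Complex.ofReal_zero, zero_mul, zero_sub, sub_zero] at h1 h2
  -- `∫ f' v = -(1/z) ∫ f' e` and `∫ f'' v = -(1/z) ∫ f'' e`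
  have hv' : ∀ g : ℝ → ℝ, ∫ t in (0 : ℝ)..d, (g t : ℂ) * v t
      = -(1 / z) * ∫ t in (0 : ℝ)..d, (g t : ℂ) * Complex.exp (-(z * t)) := by
    intro g
    rw [← intervalIntegral.integral_const_mul]
    refine integral_congr fun t _ ↦ ?_
    simp only [hv]
    field_simp
  rw [hv'] at h1 h2
  rw [h1, h2]
  field_simp
  ring

/-- The norm of the remainder: `‖∫₀^d g(t) e^{−zt} dt‖ ≤ ∫₀^d |g(t)| e^{−(Re z)t} dt` (`0 ≤ d`).
[folklore] -/
theorem norm_laplace_le (g : ℝ → ℝ) {d : ℝ} (hd : 0 ≤ d) (z : ℂ) :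
    ‖∫ t in (0 : ℝ)..d, (g t : ℂ) * Complex.exp (-(z * t))‖
      ≤ ∫ t in (0 : ℝ)..d, |g t| * Real.exp (-(z.re * t)) := by
  have h := intervalIntegral.norm_integral_le_integral_norm (f := fun t : ℝ ↦ (g t : ℂ) * Complex.exp (-(z * t)))
    (μ := volume) hd
  refine h.trans_eq (integral_congr fun t _ ↦ ?_)
  simp only [norm_mul, Complex.norm_real, Real.norm_eq_abs, Complex.norm_exp]
  congr 2
  simp [Complex.mul_re]

/-- `Re(c/z) = c·Re z/‖z‖²` for real `c`. [folklore] -/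
theorem re_ofReal_div (c : ℝ) (z : ℂ) : ((c : ℂ) / z).re = c * z.re / ‖z‖ ^ 2 := by
  rw [div_eq_mul_inv, Complex.re_ofReal_mul, Complex.inv_re, Complex.normSq_eq_norm_sq]
  ring

/-- **Kadiri's Lemma 3.2 (structure), for a general (H₁) test function.** With
`F̃(x, y) = Re ∫₀^d f(t) e^{−(x+iy)t} dt` and `M_f(x) = ∫₀^d |f''(t)| e^{−xt} dt`:
`|F̃(x, y) − f(0) x/(x² + y²)| ≤ M_f(x)/(x² + y²)` for `(x, y) ≠ (0, 0)` ("`F̃(x,y) = ηg₁(θ) x/(x²+y²)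
+ H(x,y)`, `|H(x,y)| ≤ M(x/η)η²/(x²+y²)`" for `f = ηh_θ(η·)`, see `kadiri_lemma32_mtyH1`).
[cite: Kadiri2005, Lemma 3.2] -/
theorem kadiri_lemma32 {f f' f'' : ℝ → ℝ} {d : ℝ} (hd : 0 ≤ d)
    (hf : ∀ t, HasDerivAt f (f' t) t) (hf' : ∀ t, HasDerivAt f' (f'' t) t) (hf''c : Continuous f'')
    (hfd : f d = 0) (hf'0 : f' 0 = 0) (hf'd : f' d = 0) {z : ℂ} (hz : z ≠ 0) :
    |(∫ t in (0 : ℝ)..d, (f t : ℂ) * Complex.exp (-(z * t))).re - f 0 * z.re / ‖z‖ ^ 2|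
      ≤ (∫ t in (0 : ℝ)..d, |f'' t| * Real.exp (-(z.re * t))) / ‖z‖ ^ 2 := by
  rw [laplace_eq_of_H1 hf hf' hf''c hfd hf'0 hf'd hz, Complex.add_re, re_ofReal_div,
    add_sub_cancel_left]
  have hz2 : 0 < ‖z‖ ^ 2 := by positivity
  calc |(1 / z ^ 2 * ∫ t in (0 : ℝ)..d, (f'' t : ℂ) * Complex.exp (-(z * t))).re|
      ≤ ‖1 / z ^ 2 * ∫ t in (0 : ℝ)..d, (f'' t : ℂ) * Complex.exp (-(z * t))‖ := Complex.abs_re_le_norm _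
    _ = ‖∫ t in (0 : ℝ)..d, (f'' t : ℂ) * Complex.exp (-(z * t))‖ / ‖z‖ ^ 2 := by
        rw [norm_mul, norm_div, norm_one, norm_pow]; ring
    _ ≤ _ := div_le_div_of_nonneg_right (norm_laplace_le f'' hd z) hz2.le

/-! ## Specialisation to the kernel `h^{(1)}_{1,θ}` of MTY (9.2) -/

/-- `M(x) = ∫₀^{d₁(θ)} |h''(u)| e^{−xu} du` for `h = h^{(1)}_{1,θ}` — the quantity `M(z, θ)` of
Kadiri's Lemma 3.2 / Mossinghoff–Trudgian 2015, §4 (there bounded above by `M*(z, θ)` built from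
the moments `M_k(θ)`). A definition (real-valued function), not a claim.
[cite: Kadiri2005, Lemma 3.2] [cite: MossinghoffTrudgian2015, §4] -/
def mtyM (θ x : ℝ) : ℝ :=
  ∫ u in (0 : ℝ)..mtyD1 θ, |mtyH1Deriv2 1 θ u| * Real.exp (-(x * u))

/-- `h''` of the kernel is continuous. [folklore] -/
theorem continuous_mtyH1Deriv2 (lam θ : ℝ) : Continuous (mtyH1Deriv2 lam θ) := by
  unfold mtyH1Deriv2; fun_prop

/-- **`F(z) = g₁(θ)/z + F₂(z)/z²` for the MTY kernel** (`0 < θ < π/2`, `z ≠ 0`):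
`∫₀^{d₁} h^{(1)}_{1,θ}(u) e^{−zu} du = w(0)/z + z⁻² ∫₀^{d₁} h''(u) e^{−zu} du`, `w(0) = g₁(θ) =
fordSmoothW0 θ`, from the (H₁) conditions `h(d₁) = h'(0) = h'(d₁) = 0` of
`ExplicitZeroFreeRegionKernel.lean`. [cite: Kadiri2005, Lemma 3.2 (proof)]
[cite: MossinghoffTrudgianYangRNT2024, (9.2)] -/
theorem mtyH1_laplace_eq {θ : ℝ} (hθ : 0 < θ) (hθ' : θ < π / 2) {z : ℂ} (hz : z ≠ 0) :
    ∫ u in (0 : ℝ)..mtyD1 θ, (mtyH1 1 θ u : ℂ) * Complex.exp (-(z * u))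
      = (fordSmoothW0 θ : ℂ) / z
        + 1 / z ^ 2 * ∫ u in (0 : ℝ)..mtyD1 θ, (mtyH1Deriv2 1 θ u : ℂ) * Complex.exp (-(z * u)) := by
  have hT : Real.tan θ ≠ 0 := (Real.tan_pos_of_pos_of_lt_pi_div_two hθ hθ').ne'
  have h := laplace_eq_of_H1 (d := mtyD1 θ) (hasDerivAt_mtyH1 one_ne_zero hT)
    (hasDerivAt_mtyH1Deriv 1 θ) (continuous_mtyH1Deriv2 1 θ)
    (by simpa using mtyH1_d1 (lam := 1) one_ne_zero hθ hθ')
    (mtyH1Deriv_zero 1 hθ hθ')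
    (by simpa using mtyH1Deriv_d1 (lam := 1) one_ne_zero hθ hθ') hz
  rw [h, mtyH1_one_zero hθ hθ']

/-- **Kadiri's Lemma 3.2 for the MTY kernel** (`0 < θ < π/2`, `z = x + iy ≠ 0`):
`|Re ∫₀^{d₁} h(u) e^{−zu} du − g₁(θ) x/(x²+y²)| ≤ M(x)/(x²+y²)`, `M = mtyM θ`.
[cite: Kadiri2005, Lemma 3.2] [cite: MossinghoffTrudgianYangRNT2024, §9] -/
theorem kadiri_lemma32_mtyH1 {θ : ℝ} (hθ : 0 < θ) (hθ' : θ < π / 2) {z : ℂ} (hz : z ≠ 0) :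
    |(∫ u in (0 : ℝ)..mtyD1 θ, (mtyH1 1 θ u : ℂ) * Complex.exp (-(z * u))).re
        - fordSmoothW0 θ * z.re / ‖z‖ ^ 2| ≤ mtyM θ z.re / ‖z‖ ^ 2 := by
  have hT : Real.tan θ ≠ 0 := (Real.tan_pos_of_pos_of_lt_pi_div_two hθ hθ').ne'
  have hd : 0 ≤ mtyD1 θ := by
    unfold mtyD1; linarith [theta_mul_cot_pos hθ hθ']
  have h := kadiri_lemma32 hd (hasDerivAt_mtyH1 one_ne_zero hT)
    (hasDerivAt_mtyH1Deriv 1 θ) (continuous_mtyH1Deriv2 1 θ)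
    (by simpa using mtyH1_d1 (lam := 1) one_ne_zero hθ hθ')
    (mtyH1Deriv_zero 1 hθ hθ')
    (by simpa using mtyH1Deriv_d1 (lam := 1) one_ne_zero hθ hθ') hz
  rwa [mtyH1_one_zero hθ hθ'] at h

/-- The scaled test function `f(t) = η h(ηt)` of Kadiri's method has Laplace transform
`F_f(z) = F_h(z/η)`: `∫₀^{d₁/η} η h(ηt) e^{−zt} dt = ∫₀^{d₁} h(u) e^{−(z/η)u} du` (`η > 0`).
[cite: Kadiri2005, §2.2] -/
theorem kadiri_f_laplace_eq_scaled {θ η : ℝ} (hη : 0 < η) (z : ℂ) :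
    ∫ t in (0 : ℝ)..(mtyD1 θ / η), (η * mtyH1 1 θ (η * t) : ℂ) * Complex.exp (-(z * t))
      = ∫ u in (0 : ℝ)..mtyD1 θ, (mtyH1 1 θ u : ℂ) * Complex.exp (-(z / η * u)) := by
  have hsub := intervalIntegral.smul_integral_comp_mul_left
    (fun u : ℝ ↦ (mtyH1 1 θ u : ℂ) * Complex.exp (-(z / η * u))) η (a := 0) (b := mtyD1 θ / η)
  beta_reduce at hsub
  simp only [mul_zero] at hsub
  rw [show η * (mtyD1 θ / η) = mtyD1 θ by field_simp] at hsub
  rw [← hsub, Complex.real_smul, ← intervalIntegral.integral_const_mul]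
  refine integral_congr fun t _ ↦ ?_
  have hη' : (η : ℂ) ≠ 0 := Complex.ofReal_ne_zero.2 hη.ne'
  have : z / η * ((η * t : ℝ) : ℂ) = z * t := by push_cast; field_simp
  rw [this]
  ring

/-- **Kadiri's Lemma 3.2 as printed**, for `f(t) = η h^{(1)}_{1,θ}(ηt)`:
`F̃(x, y) = ηg₁(θ) x/(x² + y²) + H(x, y)` with `|H(x, y)| ≤ M(x/η) η²/(x² + y²)`,
`M(x) = ∫₀^{d₁}|h''(u)| e^{−xu} du` (`0 < θ < π/2`, `η > 0`, `(x, y) ≠ (0, 0)`).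
[cite: Kadiri2005, Lemma 3.2] -/
theorem kadiri_lemma32_scaled {θ η : ℝ} (hθ : 0 < θ) (hθ' : θ < π / 2) (hη : 0 < η) {z : ℂ}
    (hz : z ≠ 0) :
    |(∫ t in (0 : ℝ)..(mtyD1 θ / η), (η * mtyH1 1 θ (η * t) : ℂ) * Complex.exp (-(z * t))).re
        - η * fordSmoothW0 θ * z.re / ‖z‖ ^ 2|
      ≤ mtyM θ (z.re / η) * η ^ 2 / ‖z‖ ^ 2 := by
  rw [kadiri_f_laplace_eq_scaled hη z]
  have hzη : z / η ≠ 0 := div_ne_zero hz (Complex.ofReal_ne_zero.2 hη.ne')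
  have h := kadiri_lemma32_mtyH1 hθ hθ' hzη
  have hre : (z / η).re = z.re / η := by simp [Complex.div_ofReal_re]
  have hnorm : ‖z / η‖ ^ 2 = ‖z‖ ^ 2 / η ^ 2 := by
    rw [norm_div, Complex.norm_real, Real.norm_eq_abs, abs_of_pos hη, div_pow]
  rw [hre, hnorm] at h
  have hz2 : 0 < ‖z‖ ^ 2 := by positivity
  have e1 : fordSmoothW0 θ * (z.re / η) / (‖z‖ ^ 2 / η ^ 2) = η * fordSmoothW0 θ * z.re / ‖z‖ ^ 2 := by
    field_simp
  have e2 : mtyM θ (z.re / η) / (‖z‖ ^ 2 / η ^ 2) = mtyM θ (z.re / η) * η ^ 2 / ‖z‖ ^ 2 := by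
    field_simp
  rwa [e1, e2] at h

/-! ## The real Laplace transform `F̃(x, 0)` and Kadiri's `K(w, θ)` -/

/-- The real Laplace transform of the kernel, `F̃(x, 0) = ∫₀^{d₁} h^{(1)}_{1,θ}(u) e^{−xu} du`
(Kadiri's `F̃(X, 0)` for `η = 1`; a definition). [cite: Kadiri2005, §2.2 (2.4)] -/
def mtyLaplace (θ x : ℝ) : ℝ :=
  ∫ u in (0 : ℝ)..mtyD1 θ, mtyH1 1 θ u * Real.exp (-(x * u))

/-- `x ↦ F̃(x, 0)` is non-increasing (`h ≥ 0` on `[0, d₁]`; Kadiri 2005, §4: "d'après la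
décroissance de l'application `x ↦ F̃(x, 0)`"). [cite: Kadiri2005, §4] -/
theorem antitone_mtyLaplace {θ : ℝ} (hθ : 0 < θ) (hθ' : θ < π / 2) : Antitone (mtyLaplace θ) := by
  intro x y hxy
  have hd : 0 ≤ mtyD1 θ := by unfold mtyD1; linarith [theta_mul_cot_pos hθ hθ']
  have hc : ∀ x : ℝ, Continuous fun u : ℝ ↦ mtyH1 1 θ u * Real.exp (-(x * u)) := fun x ↦ by
    have := continuous_mtyH1 1 θ; fun_prop
  refine intervalIntegral.integral_mono_on hd ((hc y).intervalIntegrable _ _)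
    ((hc x).intervalIntegrable _ _) fun u hu ↦ ?_
  refine mul_le_mul_of_nonneg_left (Real.exp_le_exp.2 (by nlinarith [hu.1])) ?_
  exact mtyH1_one_nonneg hθ hθ' hu.1 hu.2

/-- `|F(z)| ≤ F̃(Re z, 0)`: `‖∫₀^{d₁} h(u) e^{−zu} du‖ ≤ ∫₀^{d₁} h(u) e^{−(Re z)u} du` (`h ≥ 0`).
[cite: Kadiri2005, §3.2] -/
theorem norm_laplace_mtyH1_le {θ : ℝ} (hθ : 0 < θ) (hθ' : θ < π / 2) (z : ℂ) :
    ‖∫ u in (0 : ℝ)..mtyD1 θ, (mtyH1 1 θ u : ℂ) * Complex.exp (-(z * u))‖ ≤ mtyLaplace θ z.re := by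
  have hd : 0 ≤ mtyD1 θ := by unfold mtyD1; linarith [theta_mul_cot_pos hθ hθ']
  refine (norm_laplace_le (mtyH1 1 θ) hd z).trans_eq (integral_congr fun u hu ↦ ?_)
  rw [uIcc_of_le hd] at hu
  rw [abs_of_nonneg (mtyH1_one_nonneg hθ hθ' hu.1 hu.2)]

/-- Kadiri's `K(w) = ∫₀^{d₁(θ)} (a₁ e^{−u} − a₀) h_θ(u) e^{wu} du` (Kadiri 2005, §2.4;
Mossinghoff–Trudgian 2015, §2: `K(w, θ)`, "`a₀` and `a₁` are the coefficients of the first two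
terms of the selected trigonometric polynomial"), here for the kernel `h^{(1)}_{1,θ}` of MTY §9 — the
denominator of the master inequality (2.2) `R₀ ≤ A g₁(θ)(1 − κ)/(2(K(w, θ) − C(η)))`. A
definition. [cite: MossinghoffTrudgian2015, §2 (definition of K(w, θ))] [cite: Kadiri2005, §2.4] -/
def kadiriK (a₀ a₁ θ w : ℝ) : ℝ :=
  ∫ u in (0 : ℝ)..mtyD1 θ, (a₁ * Real.exp (-u) - a₀) * mtyH1 1 θ u * Real.exp (w * u)

/-- `K(w, θ) = a₁ F̃(1 − w, 0) − a₀ F̃(−w, 0)`: Kadiri's `K` in terms of the real Laplace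
transform of the kernel (Kadiri 2005, §2.4: "le terme `a₁ F̃(σ−β,0) − a₀ F̃(σ−1,0)` s'avère
être une fonction de `ω = (1−σ)/η` que nous noterons `K`"). [cite: Kadiri2005, §2.4] -/
theorem kadiriK_eq (a₀ a₁ θ w : ℝ) :
    kadiriK a₀ a₁ θ w = a₁ * mtyLaplace θ (1 - w) - a₀ * mtyLaplace θ (-w) := by
  unfold kadiriK mtyLaplace
  have hc : ∀ x : ℝ, Continuous fun u : ℝ ↦ mtyH1 1 θ u * Real.exp (-(x * u)) := fun x ↦ by
    have := continuous_mtyH1 1 θ; fun_prop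
  rw [← intervalIntegral.integral_const_mul, ← intervalIntegral.integral_const_mul,
    ← intervalIntegral.integral_sub (((hc (1 - w)).const_mul a₁).intervalIntegrable _ _)
      (((hc (-w)).const_mul a₀).intervalIntegrable _ _)]
  refine integral_congr fun u _ ↦ ?_
  have e1 : Real.exp (-u) * Real.exp (w * u) = Real.exp (-((1 - w) * u)) := by
    rw [← Real.exp_add]; congr 1; ring
  have e2 : Real.exp (w * u) = Real.exp (-(-w * u)) := by congr 1; ring
  calc (a₁ * Real.exp (-u) - a₀) * mtyH1 1 θ u * Real.exp (w * u)
      = a₁ * (mtyH1 1 θ u * (Real.exp (-u) * Real.exp (w * u)))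
        - a₀ * (mtyH1 1 θ u * Real.exp (w * u)) := by ring
    _ = _ := by rw [e1, ← e2]

end Literature.NumberTheory.LFunctions
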